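import Summits.QuantumFields.YangMills.Theorems.SwapVirialDeficitSectorLaplaceChartMeasure
import HarnessLib

/-!
# (S)-road ➎ simplified (LEAD g98 memo6 + 19:11Z∕19:15Z): `(TS)_000` FROM ONE BULK REGION WITH SURPLUS, THE B-TUBES, AND A MERGED CORE
# (free-hands support of ⟨stmt-QuantumFields-24197⟩ `SwapVirialDeficit.SwapGluedStiffness`; cell ym-idea-1, assembler fcl-p3 g47)

Sector 000 of the σ-glued ring, per GOOD sign pattern `ε`, on the chart measure `chartMeasure L = cone ⊗ ρdη` (✓`SectorLaplaceDefs` §6):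
`ℍ × GnoCoord L = (HubBulk τ × fibre) ⊔ BTube ⊔ Core`, `Core = ((TipHub τ ∪ EndHub τ) × fibre) ∖ BTube` (`BTube ⊆ (TipHub τ ∪ EndHub τ) × fibre` = the B-tubes of w3 g66,
a named measurable set of ✓Defs §7 to come).  LEAD g98's merged-core architecture (memo6 §0–§2, §4; 19:15Z stub re-cut):

* (S-bulk)  `(κ + sur)·Σ_good ∫_{HubBulk τ} I ≤ b·Σ_good ∫_{HubBulk τ} E` — the bulk carries a SURPLUS `sur = 1∕16` (its own two-sided law; fcl-p3 g47 + w2 g59);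
* (S-B)     `κ·Σ_good ∫_{BTube} e^{−bF̂} ≤ b·Σ_good ∫_{BTube} F̂e^{−bF̂}` (plain stiffness; w3 g66 + w2 g59);
* (S-core)  `κ·Σ_good ∫_{Core} e^{−bF̂} ≤ sur·Σ_good ∫_{HubBulk τ} I` — a pure WEIGHT bound, the core borrows the bulk's surplus (w2 g59 + w3 g66);
* bad signs: `κ ≤ bF̂` pointwise (✓`badSign_remainder`).

This file adds them up: §1 conversions hub-set × fibre ↔ chart measure (`setIntegral_chartMeasure_prod_univ`, `bulk_exp_chart_eq`, `bulk_action_chart_eq`) and the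
chart partition `chart_split_bulk_B_core`; §2 ★★ `goodStiffness_of_bulk_B_core` (the three good-sign inequalities ⟹ the summed good-sign chart stiffness),
★★ `sectorStiffness_of_goodSum` (summed good-sign chart stiffness + bad-sign floor ⟹ `(TS)_000` at this `b`); §3 ★★★ `h000_of_core_stubs` — the window form
`∃ K q, ∀ L b, K·L^q ≤ b → stiffKappa L (1∕8)·∫e^{−bF₀} ≤ b·∫F₀e^{−bF₀}` from the three STUBS (`∃ K k τ₀, ∀ L, ∀ τ ≤ τ₀∕L^k, ∀ b ≥ K·L^k·τ^{−k}`), for ANY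
family of measurable tubes `BT L τ ⊆ (TipHub τ ∪ EndHub τ) × fibre` = the `h0` input of ✓`swapGluedStiffness_of_windows`.

HONEST LABEL: measure-theoretic ∕ arithmetic glue; the three region inequalities are HYPOTHESES and OPEN; ⟨24197⟩ ∕ ⟨24194⟩ OPEN; ⟨24196⟩ proved elsewhere; item of record ⟨24085⟩
SubOctaveBounded aside ∕ untouched; the Yang–Mills mass gap is NOT proved; no summit is proved by a line.  THEOREMS ONLY (0 `def`, 0 `sorry`), standard axioms; the
`attribute [local instance]` block is the chart's measurable structure on `ℍ` (as in ✓`SectorLaplaceDefs`; nothing overridden).  Seat ym-line-fcl-p3 g47 (cell ym-idea-1,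
free hands), `--supports stmt-QuantumFields-24197`.  References: [cite: Luscher1983, §2]; [cite: Griffiths1964]; [folklore].
-/

set_option autoImplicit false
set_option synthInstance.maxSize 1024

noncomputable section

open MeasureTheory Quaternion Set
open scoped Quaternion BigOperators ENNReal
open Literature.MathematicalPhysics.QuantumLattice
open Literature.MathematicalPhysics.QuantumFieldTheory hiding SU2
open Summit.QuantumFields.YangMills.Theorems.SwapTwistDeficit.ToronLog

attribute [local instance] Literature.Analysis.FluidPDE.Tao2016.quatMeasurableSpace
  Literature.Analysis.FluidPDE.Tao2016.quatBorelSpace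
  Literature.MathematicalPhysics.QuantumLattice.secondCountableTopology_su2

namespace Summit.QuantumFields.YangMills.Theorems.SwapVirialDeficit.SectorLaplace

open Summit.QuantumFields.YangMills.Theorems.FemtoTransferGap
open Summit.QuantumFields.YangMills.Theorems.FemtoTransferGap.TT
open Summit.QuantumFields.YangMills.Theorems.VirialFluxGap.RingDeficit
open Summit.QuantumFields.YangMills.Theorems.SwapVirialDeficit.SwapRing
open Summit.QuantumFields.YangMills.Theorems.SwapVirialDeficit.BlowUpRing

variable {L : ℕ} [NeZero L]

/-! ## §1 Hub sets × fibre in the chart measure; the partition bulk ⊔ B-tubes ⊔ core -/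

/-- ★ `∫_{S × fibre} f d(chartMeasure) = ∫_{a∈S} (∫ f(a,η)ρ(η)dη) da` for integrable `f` and a measurable hub set `S`. [folklore] -/
theorem setIntegral_chartMeasure_prod_univ {f : ℍ × GnoCoord L → ℝ} (hf : Integrable f (chartMeasure L)) {S : Set ℍ} (hS : MeasurableSet S) :
    ∫ x in S ×ˢ (univ : Set (GnoCoord L)), f x ∂chartMeasure L = ∫ a in S, (∫ η, f (a, η) * gnoDensity η) ∂coneMeasure := by
  rw [setIntegral_chartMeasure hf (hS.prod MeasurableSet.univ), ← integral_indicator hS]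
  refine integral_congr_ae (Filter.Eventually.of_forall fun a => ?_)
  show ∫ η, (S ×ˢ (univ : Set (GnoCoord L))).indicator f (a, η) * gnoDensity η = S.indicator (fun a => ∫ η, f (a, η) * gnoDensity η) a
  by_cases ha : a ∈ S
  · rw [Set.indicator_of_mem ha]
    refine integral_congr_ae (Filter.Eventually.of_forall fun η => ?_)
    show (S ×ˢ (univ : Set (GnoCoord L))).indicator f (a, η) * gnoDensity η = f (a, η) * gnoDensity η
    rw [Set.indicator_of_mem (Set.mk_mem_prod ha (Set.mem_univ _))]
  · rw [Set.indicator_of_notMem ha]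
    have h0 : ∀ η : GnoCoord L, (S ×ˢ (univ : Set (GnoCoord L))).indicator f (a, η) * gnoDensity η = 0 := fun η => by
      rw [Set.indicator_of_notMem (fun h => ha (Set.mem_prod.1 h).1), zero_mul]
    simp only [h0, integral_zero]

/-- The Boltzmann weight `e^{−bF̂_ε}` on the chart is integrable (`b ≥ 0`). [folklore] -/
theorem integrable_chart_exp {b : ℝ} (hb : 0 ≤ b) (ε : GnoSign L) :
    Integrable (fun x : ℍ × GnoCoord L => Real.exp (-(b * gnoDeficit z₀ (fun _ => 1) x.1 ε x.2))) (chartMeasure L) :=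
  integrable_chartMeasure_of_bounded (((measurable_gnoDeficit_uncurry z₀ (fun _ => 1) ε).const_mul b).neg.exp) (M := 1) fun x => by
    rw [abs_of_pos (Real.exp_pos _)]
    exact Real.exp_le_one_iff.2 (by have := gnoDeficit_nonneg z₀ (fun _ => (1 : SU2)) x.1 ε x.2; nlinarith)

/-- The action weight `F̂_ε e^{−bF̂_ε}` on the chart is integrable (`b ≥ 0`). [folklore] -/
theorem integrable_chart_action {b : ℝ} (hb : 0 ≤ b) (ε : GnoSign L) :
    Integrable (fun x : ℍ × GnoCoord L => gnoDeficit z₀ (fun _ => 1) x.1 ε x.2 * Real.exp (-(b * gnoDeficit z₀ (fun _ => 1) x.1 ε x.2))) (chartMeasure L) := by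
  obtain ⟨B, hB0, hB⟩ := exists_abs_gnoDeficit_le (L := L)
  have hF : Measurable fun x : ℍ × GnoCoord L => gnoDeficit z₀ (fun _ => 1) x.1 ε x.2 := measurable_gnoDeficit_uncurry z₀ (fun _ => 1) ε
  exact integrable_chartMeasure_of_bounded (hF.mul (hF.const_mul b).neg.exp) (M := B) fun x => by
    rw [abs_mul, abs_of_pos (Real.exp_pos _)]
    have h1 : Real.exp (-(b * gnoDeficit z₀ (fun _ => 1) x.1 ε x.2)) ≤ 1 :=
      Real.exp_le_one_iff.2 (by have := gnoDeficit_nonneg z₀ (fun _ => (1 : SU2)) x.1 ε x.2; nlinarith)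
    calc |gnoDeficit z₀ (fun _ => 1) x.1 ε x.2| * Real.exp (-(b * gnoDeficit z₀ (fun _ => 1) x.1 ε x.2)) ≤ B * 1 :=
        mul_le_mul (hB x.1 ε x.2) h1 (Real.exp_pos _).le hB0
      _ = B := mul_one B

/-- ★ The bulk weight in hub form: `∫_{HubBulk τ × fibre} e^{−bF̂_ε} d(chartMeasure) = ∫_{HubBulk τ} hubIntegral(a,ε;b) da` (`b ≥ 0`). [folklore] -/
theorem bulk_exp_chart_eq {b : ℝ} (hb : 0 ≤ b) (ε : GnoSign L) (τ : ℝ) :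
    ∫ x in HubBulk τ ×ˢ (univ : Set (GnoCoord L)), Real.exp (-(b * gnoDeficit z₀ (fun _ => 1) x.1 ε x.2)) ∂chartMeasure L =
      ∫ a in HubBulk τ, hubIntegral a ε b ∂coneMeasure := by
  rw [setIntegral_chartMeasure_prod_univ (integrable_chart_exp hb ε) (measurableSet_hubBulk τ)]
  rfl

/-- ★ The bulk action in hub form: `∫_{HubBulk τ × fibre} F̂_ε e^{−bF̂_ε} d(chartMeasure) = ∫_{HubBulk τ} hubActionIntegral(a,ε;b) da` (`b ≥ 0`). [folklore] -/
theorem bulk_action_chart_eq {b : ℝ} (hb : 0 ≤ b) (ε : GnoSign L) (τ : ℝ) :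
    ∫ x in HubBulk τ ×ˢ (univ : Set (GnoCoord L)), gnoDeficit z₀ (fun _ => 1) x.1 ε x.2 * Real.exp (-(b * gnoDeficit z₀ (fun _ => 1) x.1 ε x.2)) ∂chartMeasure L =
      ∫ a in HubBulk τ, hubActionIntegral a ε b ∂coneMeasure := by
  rw [setIntegral_chartMeasure_prod_univ (integrable_chart_action hb ε) (measurableSet_hubBulk τ)]
  rfl

/-- ★ THE PARTITION OF THE CHART: for `τ > 0` and a measurable `BT ⊆ (TipHub τ ∪ EndHub τ) × fibre`, every integrable `g` splits as
`∫ g = ∫_{HubBulk τ × fibre} g + ∫_{BT} g + ∫_{((TipHub τ ∪ EndHub τ) × fibre) ∖ BT} g`. [folklore] -/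
theorem chart_split_bulk_B_core {g : ℍ × GnoCoord L → ℝ} (hg : Integrable g (chartMeasure L)) {τ : ℝ} (hτ : 0 < τ)
    {BT : Set (ℍ × GnoCoord L)} (hBTm : MeasurableSet BT) (hBTsub : BT ⊆ (TipHub τ ∪ EndHub τ) ×ˢ (univ : Set (GnoCoord L))) :
    ∫ x, g x ∂chartMeasure L =
      ∫ x in HubBulk τ ×ˢ (univ : Set (GnoCoord L)), g x ∂chartMeasure L + ∫ x in BT, g x ∂chartMeasure L +
        ∫ x in ((TipHub τ ∪ EndHub τ) ×ˢ (univ : Set (GnoCoord L))) \ BT, g x ∂chartMeasure L := by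
  have hTE : MeasurableSet ((TipHub τ ∪ EndHub τ) ×ˢ (univ : Set (GnoCoord L))) :=
    ((measurableSet_tipHub τ).union (measurableSet_endHub τ)).prod MeasurableSet.univ
  have hcover : HubBulk τ ×ˢ (univ : Set (GnoCoord L)) ∪ (TipHub τ ∪ EndHub τ) ×ˢ (univ : Set (GnoCoord L)) = univ := by
    rw [← Set.union_prod, Set.eq_univ_iff_forall]
    intro x
    refine Set.mk_mem_prod ?_ (Set.mem_univ _)
    have h := tipHub_union τ hτ
    have hx : x.1 ∈ TipHub τ ∪ (EndHub τ ∪ HubBulk τ) := by rw [h]; exact Set.mem_univ _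
    rcases hx with h1 | h2 | h3
    · exact Or.inr (Or.inl h1)
    · exact Or.inr (Or.inr h2)
    · exact Or.inl h3
  have hdisj : Disjoint (HubBulk τ ×ˢ (univ : Set (GnoCoord L))) ((TipHub τ ∪ EndHub τ) ×ˢ (univ : Set (GnoCoord L))) := by
    rw [Set.disjoint_prod]
    exact Or.inl (Disjoint.union_right (disjoint_tipHub_hubBulk τ).symm (disjoint_endHub_hubBulk τ).symm)
  rw [← setIntegral_univ (μ := chartMeasure L) (f := g), ← hcover, setIntegral_union hdisj hTE hg.integrableOn hg.integrableOn, add_assoc]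
  congr 1
  rw [← setIntegral_union (Set.disjoint_sdiff_right) (hTE.diff hBTm) hg.integrableOn hg.integrableOn, Set.union_sdiff_cancel hBTsub]

/-! ## §2 Adding up: bulk with surplus + B-tubes + merged core -/

set_option maxHeartbeats 400000 in
/-- ★★ **THE GOOD-SIGN CHART STIFFNESS FROM (S-bulk), (S-B), (S-core)** (LEAD g98 memo6 ∕ 19:15Z): fixed `L`, `b > 0`, cut `τ > 0`, surplus `sur`, any `κ`, tubes
`BT ⊆ (TipHub τ ∪ EndHub τ) × fibre`: the bulk stiffness with surplus, the plain B-tube stiffness and the core weight bound (against the bulk alone) give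
`κ·Σ_good ∫ e^{−bF̂_ε} d(chartMeasure) ≤ b·Σ_good ∫ F̂_ε e^{−bF̂_ε} d(chartMeasure)`. [cite: Griffiths1964] -/
theorem goodStiffness_of_bulk_B_core {κ sur b τ : ℝ} (hτ : 0 < τ) (hb : 0 < b)
    {BT : Set (ℍ × GnoCoord L)} (hBTm : MeasurableSet BT) (hBTsub : BT ⊆ (TipHub τ ∪ EndHub τ) ×ˢ (univ : Set (GnoCoord L)))
    (hbulk : (κ + sur) * ∑ ε ∈ (Finset.univ.filter fun ε : GnoSign L => GoodSign ε), ∫ a in HubBulk τ, hubIntegral a ε b ∂coneMeasure ≤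
      b * ∑ ε ∈ (Finset.univ.filter fun ε : GnoSign L => GoodSign ε), ∫ a in HubBulk τ, hubActionIntegral a ε b ∂coneMeasure)
    (hB : κ * ∑ ε ∈ (Finset.univ.filter fun ε : GnoSign L => GoodSign ε), ∫ x in BT, Real.exp (-(b * gnoDeficit z₀ (fun _ => 1) x.1 ε x.2)) ∂chartMeasure L ≤
      b * ∑ ε ∈ (Finset.univ.filter fun ε : GnoSign L => GoodSign ε),
        ∫ x in BT, gnoDeficit z₀ (fun _ => 1) x.1 ε x.2 * Real.exp (-(b * gnoDeficit z₀ (fun _ => 1) x.1 ε x.2)) ∂chartMeasure L)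
    (hcore : κ * ∑ ε ∈ (Finset.univ.filter fun ε : GnoSign L => GoodSign ε),
        ∫ x in ((TipHub τ ∪ EndHub τ) ×ˢ (univ : Set (GnoCoord L))) \ BT, Real.exp (-(b * gnoDeficit z₀ (fun _ => 1) x.1 ε x.2)) ∂chartMeasure L ≤
      sur * ∑ ε ∈ (Finset.univ.filter fun ε : GnoSign L => GoodSign ε), ∫ a in HubBulk τ, hubIntegral a ε b ∂coneMeasure) :
    κ * ∑ ε ∈ (Finset.univ.filter fun ε : GnoSign L => GoodSign ε), ∫ x, Real.exp (-(b * gnoDeficit z₀ (fun _ => 1) x.1 ε x.2)) ∂chartMeasure L ≤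
      b * ∑ ε ∈ (Finset.univ.filter fun ε : GnoSign L => GoodSign ε),
        ∫ x, gnoDeficit z₀ (fun _ => 1) x.1 ε x.2 * Real.exp (-(b * gnoDeficit z₀ (fun _ => 1) x.1 ε x.2)) ∂chartMeasure L := by
  -- abbreviations for the six summed pieces
  set G : Finset (GnoSign L) := Finset.univ.filter (fun ε : GnoSign L => GoodSign ε) with hG
  set N : Set (ℍ × GnoCoord L) := ((TipHub τ ∪ EndHub τ) ×ˢ (univ : Set (GnoCoord L))) \ BT with hN
  set Zb : ℝ := ∑ ε ∈ G, ∫ a in HubBulk τ, hubIntegral a ε b ∂coneMeasure with hZb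
  set Eb : ℝ := ∑ ε ∈ G, ∫ a in HubBulk τ, hubActionIntegral a ε b ∂coneMeasure with hEb
  set ZB : ℝ := ∑ ε ∈ G, ∫ x in BT, Real.exp (-(b * gnoDeficit z₀ (fun _ => 1) x.1 ε x.2)) ∂chartMeasure L with hZB
  set EB : ℝ := ∑ ε ∈ G, ∫ x in BT, gnoDeficit z₀ (fun _ => 1) x.1 ε x.2 * Real.exp (-(b * gnoDeficit z₀ (fun _ => 1) x.1 ε x.2)) ∂chartMeasure L with hEB
  set Zc : ℝ := ∑ ε ∈ G, ∫ x in N, Real.exp (-(b * gnoDeficit z₀ (fun _ => 1) x.1 ε x.2)) ∂chartMeasure L with hZc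
  set Ec : ℝ := ∑ ε ∈ G, ∫ x in N, gnoDeficit z₀ (fun _ => 1) x.1 ε x.2 * Real.exp (-(b * gnoDeficit z₀ (fun _ => 1) x.1 ε x.2)) ∂chartMeasure L with hEc
  -- the splittings
  have eZ : ∑ ε ∈ G, ∫ x, Real.exp (-(b * gnoDeficit z₀ (fun _ => 1) x.1 ε x.2)) ∂chartMeasure L = Zb + ZB + Zc := by
    rw [hZb, hZB, hZc, ← Finset.sum_add_distrib, ← Finset.sum_add_distrib]
    refine Finset.sum_congr rfl fun ε _ => ?_
    rw [chart_split_bulk_B_core (integrable_chart_exp hb.le ε) hτ hBTm hBTsub, bulk_exp_chart_eq hb.le ε τ]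
  have eE : ∑ ε ∈ G, ∫ x, gnoDeficit z₀ (fun _ => 1) x.1 ε x.2 * Real.exp (-(b * gnoDeficit z₀ (fun _ => 1) x.1 ε x.2)) ∂chartMeasure L = Eb + EB + Ec := by
    rw [hEb, hEB, hEc, ← Finset.sum_add_distrib, ← Finset.sum_add_distrib]
    refine Finset.sum_congr rfl fun ε _ => ?_
    rw [chart_split_bulk_B_core (integrable_chart_action hb.le ε) hτ hBTm hBTsub, bulk_action_chart_eq hb.le ε τ]
  -- the core action is non-negative
  have hEc0 : 0 ≤ Ec := by
    rw [hEc]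
    refine Finset.sum_nonneg fun ε _ => ?_
    refine setIntegral_nonneg (((((measurableSet_tipHub τ).union (measurableSet_endHub τ)).prod MeasurableSet.univ)).diff hBTm) fun x _ => ?_
    exact mul_nonneg (gnoDeficit_nonneg _ _ _ _ _) (Real.exp_pos _).le
  rw [eZ, eE]
  have h1 : κ * Zb + sur * Zb ≤ b * Eb := by linarith [hbulk]
  have h2 : κ * ZB ≤ b * EB := hB
  have h3 : κ * Zc ≤ sur * Zb := hcore
  have h4 : 0 ≤ b * Ec := mul_nonneg hb.le hEc0
  nlinarith [h1, h2, h3, h4]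

set_option maxHeartbeats 400000 in
/-- ★★ **`(TS)_000` AT FIXED `L`, `b > 0`, FROM THE SUMMED GOOD-SIGN CHART STIFFNESS** and the bad-sign pointwise floor `κ ≤ bF̂` at every hub `a ≠ 0`
(✓`badSign_remainder`): `κ·∫e^{−bF₀}dμ_L ≤ b·∫F₀e^{−bF₀}dμ_L`. [cite: Luscher1983, §2] -/
theorem sectorStiffness_of_goodSum {κ b : ℝ} (hb : 0 < b)
    (hgood : κ * ∑ ε ∈ (Finset.univ.filter fun ε : GnoSign L => GoodSign ε), ∫ x, Real.exp (-(b * gnoDeficit z₀ (fun _ => 1) x.1 ε x.2)) ∂chartMeasure L ≤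
      b * ∑ ε ∈ (Finset.univ.filter fun ε : GnoSign L => GoodSign ε),
        ∫ x, gnoDeficit z₀ (fun _ => 1) x.1 ε x.2 * Real.exp (-(b * gnoDeficit z₀ (fun _ => 1) x.1 ε x.2)) ∂chartMeasure L)
    (hbad : ∀ a : ℍ, a ≠ 0 → ∀ ε : GnoSign L, ¬ GoodSign ε → ∀ η : GnoCoord L, κ ≤ b * gnoDeficit z₀ (fun _ => 1) a ε η) :
    κ * ∫ P, Real.exp (-(b * swapRingDeficit L z₀ P)) ∂(ringMeasure L) ≤
      b * ∫ P, swapRingDeficit L z₀ P * Real.exp (-(b * swapRingDeficit L z₀ P)) ∂(ringMeasure L) := by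
  haveI := isFiniteMeasure_chartMeasure (L := L)
  rw [sector_exp_eq_chartMeasure hb.le, sector_action_eq_chartMeasure hb.le]
  -- bad patterns one at a time
  have hper : ∀ ε : GnoSign L, ¬ GoodSign ε → κ * ∫ x, Real.exp (-(b * gnoDeficit z₀ (fun _ => 1) x.1 ε x.2)) ∂chartMeasure L ≤
      b * ∫ x, gnoDeficit z₀ (fun _ => 1) x.1 ε x.2 * Real.exp (-(b * gnoDeficit z₀ (fun _ => 1) x.1 ε x.2)) ∂chartMeasure L := by
    intro ε hε
    rw [← integral_const_mul, ← integral_const_mul]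
    refine integral_mono_ae ((integrable_chart_exp hb.le ε).const_mul κ) ((integrable_chart_action hb.le ε).const_mul b) ?_
    refine (ae_hub_re_im_ne_zero_chartMeasure (L := L)).mono fun x hx => ?_
    have ha : x.1 ≠ 0 := fun h0 => hx.1 (by rw [h0]; rfl)
    have hpt := hbad x.1 ha ε hε x.2
    have he : 0 ≤ Real.exp (-(b * gnoDeficit z₀ (fun _ => 1) x.1 ε x.2)) := (Real.exp_pos _).le
    calc κ * Real.exp (-(b * gnoDeficit z₀ (fun _ => 1) x.1 ε x.2))
        ≤ (b * gnoDeficit z₀ (fun _ => 1) x.1 ε x.2) * Real.exp (-(b * gnoDeficit z₀ (fun _ => 1) x.1 ε x.2)) := mul_le_mul_of_nonneg_right hpt he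
      _ = b * (gnoDeficit z₀ (fun _ => 1) x.1 ε x.2 * Real.exp (-(b * gnoDeficit z₀ (fun _ => 1) x.1 ε x.2))) := by ring
  have hbad' : κ * ∑ ε ∈ (Finset.univ.filter fun ε : GnoSign L => ¬ GoodSign ε), ∫ x, Real.exp (-(b * gnoDeficit z₀ (fun _ => 1) x.1 ε x.2)) ∂chartMeasure L ≤
      b * ∑ ε ∈ (Finset.univ.filter fun ε : GnoSign L => ¬ GoodSign ε),
        ∫ x, gnoDeficit z₀ (fun _ => 1) x.1 ε x.2 * Real.exp (-(b * gnoDeficit z₀ (fun _ => 1) x.1 ε x.2)) ∂chartMeasure L := by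
    rw [Finset.mul_sum, Finset.mul_sum]
    refine Finset.sum_le_sum fun ε hε => ?_
    rw [Finset.mem_filter] at hε
    exact hper ε hε.2
  -- add good and bad and multiply by `K_L ≥ 0`
  have hKL : 0 ≤ KL L := KL_nonneg
  have h := add_le_add hgood hbad'
  rw [← mul_add, ← mul_add, Finset.sum_filter_add_sum_filter_not, Finset.sum_filter_add_sum_filter_not] at h
  calc κ * (KL L * ∑ ε : GnoSign L, ∫ x, Real.exp (-(b * gnoDeficit z₀ (fun _ => 1) x.1 ε x.2)) ∂chartMeasure L)
      = KL L * (κ * ∑ ε : GnoSign L, ∫ x, Real.exp (-(b * gnoDeficit z₀ (fun _ => 1) x.1 ε x.2)) ∂chartMeasure L) := by ring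
    _ ≤ KL L * (b * ∑ ε : GnoSign L, ∫ x, gnoDeficit z₀ (fun _ => 1) x.1 ε x.2 * Real.exp (-(b * gnoDeficit z₀ (fun _ => 1) x.1 ε x.2)) ∂chartMeasure L) :=
        mul_le_mul_of_nonneg_left h hKL
    _ = b * (KL L * ∑ ε : GnoSign L, ∫ x, gnoDeficit z₀ (fun _ => 1) x.1 ε x.2 * Real.exp (-(b * gnoDeficit z₀ (fun _ => 1) x.1 ε x.2)) ∂chartMeasure L) := by
        ring

/-! ## §3 The polynomial window of sector 000 from the three stubs -/

set_option maxHeartbeats 400000 in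
/-- ★★★ **`(TS)_000` ON A POLYNOMIAL WINDOW FROM THE STUBS (S-bulk), (S-B), (S-core)** of the merged-core skeleton: for any family of measurable tubes
`BT L τ ⊆ (TipHub τ ∪ EndHub τ) × fibre`, the bulk stiffness with surplus `1∕16`, the plain B-tube stiffness and the core weight bound (each `∃ K > 0, k, τ₀ ∈ (0,1∕2]`,
then ∀ `L`, ∀ cut `0 < τ ≤ τ₀∕L^k`, ∀ `b ≥ K·L^k·τ^{−k}`, with `κ = stiffKappa L (1∕8)`) give `∃ K q, ∀ L b, K·L^q ≤ b → stiffKappa L (1∕8)·∫e^{−bF₀} ≤ b·∫F₀e^{−bF₀}`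
(one common cut `τ(L) = τ₀∕L^k`; bad signs above `8100L¹⁰`). [cite: Griffiths1964] -/
theorem h000_of_core_stubs (BT : ∀ L : ℕ, ℝ → Set (ℍ × GnoCoord L))
    (hBTm : ∀ (L : ℕ) (τ : ℝ), MeasurableSet (BT L τ))
    (hBTsub : ∀ (L : ℕ) [NeZero L] (τ : ℝ), BT L τ ⊆ (TipHub τ ∪ EndHub τ) ×ˢ (univ : Set (GnoCoord L)))
    (hbulk : ∃ K : ℝ, 0 < K ∧ ∃ k : ℕ, ∃ τ₀ : ℝ, 0 < τ₀ ∧ τ₀ ≤ 1 / 2 ∧ ∀ (L : ℕ) [NeZero L] (τ : ℝ), 0 < τ → τ ≤ τ₀ / (L : ℝ) ^ k →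
      ∀ b : ℝ, K * (L : ℝ) ^ k * τ⁻¹ ^ k ≤ b →
        (stiffKappa L (1 / 8) + 1 / 16) * ∑ ε ∈ (Finset.univ.filter fun ε : GnoSign L => GoodSign ε), ∫ a in HubBulk τ, hubIntegral a ε b ∂coneMeasure ≤
          b * ∑ ε ∈ (Finset.univ.filter fun ε : GnoSign L => GoodSign ε), ∫ a in HubBulk τ, hubActionIntegral a ε b ∂coneMeasure)
    (hB : ∃ K : ℝ, 0 < K ∧ ∃ k : ℕ, ∃ τ₀ : ℝ, 0 < τ₀ ∧ τ₀ ≤ 1 / 2 ∧ ∀ (L : ℕ) [NeZero L] (τ : ℝ), 0 < τ → τ ≤ τ₀ / (L : ℝ) ^ k →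
      ∀ b : ℝ, K * (L : ℝ) ^ k * τ⁻¹ ^ k ≤ b →
        stiffKappa L (1 / 8) * ∑ ε ∈ (Finset.univ.filter fun ε : GnoSign L => GoodSign ε),
            ∫ x in BT L τ, Real.exp (-(b * gnoDeficit z₀ (fun _ => 1) x.1 ε x.2)) ∂chartMeasure L ≤
          b * ∑ ε ∈ (Finset.univ.filter fun ε : GnoSign L => GoodSign ε),
            ∫ x in BT L τ, gnoDeficit z₀ (fun _ => 1) x.1 ε x.2 * Real.exp (-(b * gnoDeficit z₀ (fun _ => 1) x.1 ε x.2)) ∂chartMeasure L)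
    (hcore : ∃ K : ℝ, 0 < K ∧ ∃ k : ℕ, ∃ τ₀ : ℝ, 0 < τ₀ ∧ τ₀ ≤ 1 / 2 ∧ ∀ (L : ℕ) [NeZero L] (τ : ℝ), 0 < τ → τ ≤ τ₀ / (L : ℝ) ^ k →
      ∀ b : ℝ, K * (L : ℝ) ^ k * τ⁻¹ ^ k ≤ b →
        stiffKappa L (1 / 8) * ∑ ε ∈ (Finset.univ.filter fun ε : GnoSign L => GoodSign ε),
            ∫ x in ((TipHub τ ∪ EndHub τ) ×ˢ (univ : Set (GnoCoord L))) \ BT L τ, Real.exp (-(b * gnoDeficit z₀ (fun _ => 1) x.1 ε x.2)) ∂chartMeasure L ≤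
          (1 / 16 : ℝ) * ∑ ε ∈ (Finset.univ.filter fun ε : GnoSign L => GoodSign ε), ∫ a in HubBulk τ, hubIntegral a ε b ∂coneMeasure) :
    ∃ K : ℝ, 0 < K ∧ ∃ q : ℕ, ∀ (L : ℕ) [NeZero L] (b : ℝ), K * (L : ℝ) ^ q ≤ b →
      stiffKappa L (1 / 8) * ∫ P, Real.exp (-(b * swapRingDeficit L z₀ P)) ∂(ringMeasure L) ≤
        b * ∫ P, swapRingDeficit L z₀ P * Real.exp (-(b * swapRingDeficit L z₀ P)) ∂(ringMeasure L) := by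
  obtain ⟨Kt, hKt, kt, τt, hτt, hτt1, ht⟩ := hbulk
  obtain ⟨Kb, hKb, kb, τb, hτb, hτb1, hbk⟩ := hB
  obtain ⟨Ke, hKe, ke, τe, hτe, hτe1, he⟩ := hcore
  -- common cut exponent and cut size
  set k : ℕ := max kt (max kb ke) with hk
  set τ₀ : ℝ := min τt (min τb τe) with hτ₀
  have hτ₀0 : 0 < τ₀ := lt_min hτt (lt_min hτb hτe)
  have hτ₀t : τ₀ ≤ τt := min_le_left _ _
  have hτ₀b : τ₀ ≤ τb := (min_le_right _ _).trans (min_le_left _ _)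
  have hτ₀e : τ₀ ≤ τe := (min_le_right _ _).trans (min_le_right _ _)
  have hτ₀1 : τ₀ ≤ 1 / 2 := hτ₀t.trans hτt1
  have hkt : kt ≤ k := le_max_left _ _
  have hkb : kb ≤ k := (le_max_left _ _).trans (le_max_right _ _)
  have hke : ke ≤ k := (le_max_right _ _).trans (le_max_right _ _)
  refine ⟨(Kt + Kb + Ke) / τ₀ ^ k + 8100, by positivity, k + k * k + 10, fun L _ b hb => ?_⟩
  have hL1 : (1 : ℝ) ≤ L := by exact_mod_cast NeZero.one_le
  have hL0 : (0 : ℝ) < L := by linarith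
  set τ : ℝ := τ₀ / (L : ℝ) ^ k with hτdef
  have hLk : (1 : ℝ) ≤ (L : ℝ) ^ k := one_le_pow₀ hL1
  have hLk0 : (0 : ℝ) < (L : ℝ) ^ k := by positivity
  have hτ0 : 0 < τ := div_pos hτ₀0 hLk0
  have hτle : ∀ {τ' : ℝ} {k' : ℕ}, τ₀ ≤ τ' → k' ≤ k → τ ≤ τ' / (L : ℝ) ^ k' := fun hτ' hk' =>
    div_le_div₀ (le_trans hτ₀0.le hτ') hτ' (by positivity) (pow_le_pow_right₀ hL1 hk')
  have eτi : τ⁻¹ = (L : ℝ) ^ k / τ₀ := by rw [hτdef, inv_div]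
  have hτi1 : 1 ≤ τ⁻¹ := by
    rw [eτi, le_div_iff₀ hτ₀0]; linarith
  have hbig : (Kt + Kb + Ke) / τ₀ ^ k * (L : ℝ) ^ (k + k * k) ≤ b := by
    have h1 : (Kt + Kb + Ke) / τ₀ ^ k * (L : ℝ) ^ (k + k * k) ≤ ((Kt + Kb + Ke) / τ₀ ^ k + 8100) * (L : ℝ) ^ (k + k * k + 10) := by
      have hLm : (L : ℝ) ^ (k + k * k) ≤ (L : ℝ) ^ (k + k * k + 10) := pow_le_pow_right₀ hL1 (by omega)
      have h0 : 0 ≤ (Kt + Kb + Ke) / τ₀ ^ k := by positivity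
      nlinarith [hLm, h0, one_le_pow₀ (n := k + k * k + 10) hL1]
    exact h1.trans hb
  have hthr : ∀ {K' : ℝ} {k' : ℕ}, 0 < K' → K' ≤ Kt + Kb + Ke → k' ≤ k → K' * (L : ℝ) ^ k' * τ⁻¹ ^ k' ≤ b := by
    intro K' k' hK' hK'le hk'
    have h1 : τ⁻¹ ^ k' ≤ τ⁻¹ ^ k := pow_le_pow_right₀ hτi1 hk'
    have h2 : τ⁻¹ ^ k = (L : ℝ) ^ (k * k) / τ₀ ^ k := by rw [eτi, div_pow, ← pow_mul]
    have h3 : (L : ℝ) ^ k' ≤ (L : ℝ) ^ k := pow_le_pow_right₀ hL1 hk'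
    calc K' * (L : ℝ) ^ k' * τ⁻¹ ^ k' ≤ (Kt + Kb + Ke) * (L : ℝ) ^ k * τ⁻¹ ^ k :=
          mul_le_mul (mul_le_mul hK'le h3 (by positivity) (by linarith)) h1 (by positivity) (by positivity)
      _ = (Kt + Kb + Ke) / τ₀ ^ k * (L : ℝ) ^ (k + k * k) := by rw [h2, pow_add]; field_simp
      _ ≤ b := hbig
  have hbad_thr : 8100 * (L : ℝ) ^ 10 ≤ b := by
    have h1 : 8100 * (L : ℝ) ^ 10 ≤ ((Kt + Kb + Ke) / τ₀ ^ k + 8100) * (L : ℝ) ^ (k + k * k + 10) := by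
      have hLm : (L : ℝ) ^ 10 ≤ (L : ℝ) ^ (k + k * k + 10) := pow_le_pow_right₀ hL1 (by omega)
      have h0 : 0 ≤ (Kt + Kb + Ke) / τ₀ ^ k := by positivity
      nlinarith [hLm, h0, one_le_pow₀ (n := k + k * k + 10) hL1, pow_nonneg hL0.le 10]
    exact h1.trans hb
  have hb0 : 0 < b := lt_of_lt_of_le (by positivity) hbad_thr
  exact sectorStiffness_of_goodSum hb0
    (goodStiffness_of_bulk_B_core hτ0 hb0 (hBTm L τ) (hBTsub L τ)
      (ht L τ hτ0 (hτle hτ₀t hkt) b (hthr hKt (by linarith) hkt))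
      (hbk L τ hτ0 (hτle hτ₀b hkb) b (hthr hKb (by linarith) hkb))
      (he L τ hτ0 (hτle hτ₀e hke) b (hthr hKe (by linarith) hke)))
    (badSign_remainder (by norm_num) hbad_thr)

end Summit.QuantumFields.YangMills.Theorems.SwapVirialDeficit.SectorLaplace

end
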